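import Mathlib
import Summits.ResolutionOfSingularities.ResolutionOfSingularities.Theorems.RadicialJungCleanModelsCleanPatchingDefs
import Summits.ResolutionOfSingularities.ResolutionOfSingularities.Theorems.RadicialJungCleanModelsCleanRegTransport
import Summits.ResolutionOfSingularities.ResolutionOfSingularities.Theorems.RadicialJungCleanModelsZeroDimValuations
import Summits.ResolutionOfSingularities.ResolutionOfSingularities.Theorems.RadicialJungCleanModelsCleanChartsSpread
import Literature.AlgebraicGeometry.Resolution.LocalBlowup
import Literature.AlgebraicGeometry.Resolution.FieldsJ2
import HarnessLib

/-!
# [stub `stub_cleanCharts3` of line `Sketch` rev 14] CLEAN CHARTS (crux stmt-ResolutionOfSingularities-15917,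
# `RadicialJung.CleanModels`)

The registered stub 4a of `Cruxes/CleanModels/Lines/Sketch.lean` rev 14: clean local uniformization at 3-dimensional
centres (`CleanLU3`, the hypothesis `hLU` — discharged in the skeleton by the landed `stub_cleanLU3_of_frame` fed with
the named fact F-110) gives, inside EVERY valuation ring `O` centred on a regular affine threefold chart `A` (finitely
generated, `Frac A = K`, `dim A ≤ 3`, all maximal localisations regular of dimension `3`), a finitely generated
`A ≤ T ⊆ O` ALL of whose local rings `locAtCentre T O'` are clean-regular for the `K^p`-line of `g₀` (`CleanRegAt`).

Proof (lead `res-B-lead-1` g1): (1) refine `O` to a ZERO-DIMENSIONAL `A ⊆ O₀ ≤ O` (`exists_zeroDim_refinement`: a minimal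
refinement; all its centres on intermediate subrings are maximal ideals); (2) the centre of `O₀` on `A` is maximal, so
`A_𝔭` is regular of dimension `3` and `hLU` applies AT `O₀`: `A ≤ A' ⊆ O₀` with `locAtCentre A' O₀` clean-regular, at a centre
which is again a MAXIMAL ideal `𝔭'`; (3) `exists_spread_of_looseCleanForm`: after a twist of the representative, a
hypersurface `h₂ ∉ 𝔭'` off which it is loosely clean at every REGULAR `A'_𝔮`, `𝔮 ≠ 𝔭'`; (4) the regular locus of `A'` is open
(`isJ2Ring_of_field`): `h₁ ∉ 𝔭'` with `D(h₁) ⊆ Reg A'`; (5) `T := A'[1/(h₁h₂)] ⊆ O₀` (the inverse has value `1`); for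
`T ⊆ O'` the centre `𝔮` of `O'` on `A'` misses `h₁ h₂`, `locAtCentre T O' = locAtCentre A' O'` is regular, and clean — by the
spread if `𝔮 ≠ 𝔭'`, and because `locAtCentre A' O' = locAtCentre A' O₀` if `𝔮 = 𝔭'`.

Honest framing: this is the `P_clean` version of Zariski's «uniformizing affine models» (Piltant 2013 Axiom 5 + Axiom 1 at
closed points); nothing here proves resolution in characteristic `p` or any case of `CleanModels` by itself.
-/

noncomputable section

set_option linter.dupNamespace false -- mandated namespace of this single-conjunct summit

open IsLocalRing
open Literature.AlgebraicGeometry.Resolution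

namespace Summit.ResolutionOfSingularities.ResolutionOfSingularities.Theorems.RadicialJung.CleanModels

variable {K : Type} [Field K] {p : ℕ}

/-! ## Bookkeeping -/

/-- The old three-form disjunction of `stub_cleanLU3_of_frame` (coercions to `K` written out) is a `LooseCleanForm` read
through the inclusion `R ⊆ K`. [folklore] -/
theorem looseCleanForm_of_forms {R : Subring K} [IsRegularLocalRing R] {X : K}
    (h : (∃ (d m : ℕ) (hmd : m ≤ d) (t : Fin d → R) (a : Fin m → ℕ) (u : R), IsUnit u ∧
        Ideal.span (Set.range t) = maximalIdeal R ∧ ringKrullDim R = (d : WithBot ℕ∞) ∧ 0 < m ∧ (∀ i, ¬ p ∣ a i) ∧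
        X = (u : K) * ∏ i : Fin m, ((t (Fin.castLE hmd i) : R) : K) ^ (a i)) ∨
      (∃ u : R, IsUnit u ∧ X = (u : K) ∧ ∀ c' : R, u - c' ^ p ∉ maximalIdeal R) ∨
      (∃ s c' : R, X = (s : K) ∧ s - c' ^ p ∈ maximalIdeal R ∧ s - c' ^ p ∉ maximalIdeal R ^ 2)) :
    LooseCleanForm p R.subtype X := by
  rcases h with ⟨d, m, hmd, t, a, u, hu, hspan, hdim, hm, ha, hX⟩ | ⟨u, hu, hX, hc⟩ | ⟨s, c', hX, h1, h2⟩
  · refine Or.inl ⟨d, m, hmd, t, a, u, hu, hspan, hdim, hm, ha, ?_⟩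
    rw [hX, map_mul, map_prod]
    simp only [map_pow, Subring.coe_subtype]
  · exact Or.inr (Or.inl ⟨u, hu, hX, hc⟩)
  · exact Or.inr (Or.inr ⟨s, c', hX, h1, h2⟩)

/-- Valuation rings with the same centre on `B` have the same local ring `B_𝔭 ⊆ K`. [folklore] -/
theorem locAtCentre_eq_of_subringCentre_eq {B : Subring K} {O O' : ValuationSubring K} (h : B ≤ O.toSubring)
    (h' : B ≤ O'.toSubring) (hc : subringCentre B O h = subringCentre B O' h') :
    locAtCentre B O = locAtCentre B O' := by
  have key : ∀ z ∈ B, O.valuation z = 1 ↔ O'.valuation z = 1 := by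
    intro z hz
    have h1 : O.valuation z = 1 ↔ (⟨z, hz⟩ : B) ∉ subringCentre B O h := by
      rw [mem_subringCentre_iff, not_lt]
      exact ⟨fun e => e.ge, fun hle => le_antisymm ((O.valuation_le_one_iff _).mpr (h hz)) hle⟩
    have h2 : O'.valuation z = 1 ↔ (⟨z, hz⟩ : B) ∉ subringCentre B O' h' := by
      rw [mem_subringCentre_iff, not_lt]
      exact ⟨fun e => e.ge, fun hle => le_antisymm ((O'.valuation_le_one_iff _).mpr (h' hz)) hle⟩
    rw [h1, h2, hc]
  ext x
  simp only [mem_locAtCentre_iff]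
  constructor
  · rintro ⟨y, hy, z, hz, hv, rfl⟩
    exact ⟨y, hy, z, hz, (key z hz).mp hv, rfl⟩
  · rintro ⟨y, hy, z, hz, hv, rfl⟩
    exact ⟨y, hy, z, hz, (key z hz).mpr hv, rfl⟩

/-- A nonzero element of `O'` whose inverse is also in `O'` has value `1`. [folklore] -/
theorem valuation_eq_one_of_inv_mem {O' : ValuationSubring K} {x : K} (hx0 : x ≠ 0) (hx : x ∈ O')
    (hinv : x⁻¹ ∈ O') : O'.valuation x = 1 := by
  have h1 : O'.valuation x ≤ 1 := (O'.valuation_le_one_iff x).mpr hx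
  have h2 : O'.valuation x⁻¹ ≤ 1 := (O'.valuation_le_one_iff _).mpr hinv
  rw [map_inv₀] at h2
  have hv0 : O'.valuation x ≠ 0 := (map_ne_zero _).mpr hx0
  exact le_antisymm h1 ((inv_le_one₀ (zero_lt_iff.mpr hv0)).mp h2)

/-- `locAtCentre` does not see intermediate rings below it: if `B ≤ T ≤ B_𝔭` then `T_𝔭 = B_𝔭`. [folklore] -/
theorem locAtCentre_eq_of_le_of_le {B T : Subring K} {O : ValuationSubring K} (hBT : B ≤ T)
    (hT : T ≤ locAtCentre B O) : locAtCentre T O = locAtCentre B O :=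
  le_antisymm ((locAtCentre_mono O hT).trans (locAtCentre_locAtCentre B O).le) (locAtCentre_mono O hBT)

/-! ## The stub -/

/-- **Stub 4a `stub_cleanCharts3` (Sketch rev 14): CLEAN CHARTS inside every valuation ring centred on a regular affine
threefold chart**, from clean local uniformization at 3-dimensional centres (`hLU` = `CleanLU3`).  See the module docstring
for the proof (zero-dimensional refinement, `CleanLU3` at the refinement, spreading from the closed centre, regular locus,
inverting one element). [cite: Piltant2013, §2 Axiom 5 and Axiom 1] -/
theorem stub_cleanCharts3
    (hLU : ∀ (p : ℕ), p.Prime →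
    ∀ (k : Type) [Field k] [CharP k p] (K : Type) [Field K] [Algebra k K]
    (O : ValuationSubring K) (A : Subalgebra k K), A.toSubring ≤ O.toSubring → A.FG → IsFractionRing A K →
    ringKrullDim A ≤ 3 → IsRegularLocalRing (locAtCentre A.toSubring O) →
    ringKrullDim (locAtCentre A.toSubring O) = 3 →
    ∀ g₀ : K, (∀ c : K, c ^ p ≠ g₀) →
    ∃ (A' : Subalgebra k K), A'.toSubring ≤ O.toSubring ∧ A ≤ A' ∧ A'.FG ∧
    ∃ (_ : IsRegularLocalRing (locAtCentre A'.toSubring O)) (c : Fin p → K), (∃ j : Fin p, (j : ℕ) ≠ 0 ∧ c j ≠ 0) ∧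
    ((∃ (d m : ℕ) (hmd : m ≤ d) (t : Fin d → ↥(locAtCentre A'.toSubring O)) (a : Fin m → ℕ) (u : ↥(locAtCentre A'.toSubring O)), IsUnit u ∧
    Ideal.span (Set.range t) = IsLocalRing.maximalIdeal ↥(locAtCentre A'.toSubring O) ∧
    ringKrullDim ↥(locAtCentre A'.toSubring O) = (d : WithBot ℕ∞) ∧ 0 < m ∧ (∀ i, ¬ p ∣ a i) ∧
    (∑ j : Fin p, c j ^ p * g₀ ^ (j : ℕ)) = (u : K) * ∏ i : Fin m, ((t (Fin.castLE hmd i) : ↥(locAtCentre A'.toSubring O)) : K) ^ (a i)) ∨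
    (∃ u : ↥(locAtCentre A'.toSubring O), IsUnit u ∧ (∑ j : Fin p, c j ^ p * g₀ ^ (j : ℕ)) = (u : K) ∧
    ∀ c' : ↥(locAtCentre A'.toSubring O), u - c' ^ p ∉ IsLocalRing.maximalIdeal ↥(locAtCentre A'.toSubring O)) ∨
    (∃ s c' : ↥(locAtCentre A'.toSubring O), (∑ j : Fin p, c j ^ p * g₀ ^ (j : ℕ)) = (s : K) ∧
    s - c' ^ p ∈ IsLocalRing.maximalIdeal ↥(locAtCentre A'.toSubring O) ∧
    s - c' ^ p ∉ IsLocalRing.maximalIdeal ↥(locAtCentre A'.toSubring O) ^ 2))) :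
    ∀ (p : ℕ), p.Prime → ∀ (k : Type) [Field k] [CharP k p] (K : Type) [Field K] [Algebra k K]
      (O : ValuationSubring K) (A : Subalgebra k K), A.toSubring ≤ O.toSubring → A.FG → IsFractionRing A K →
      ringKrullDim A ≤ 3 →
      (∀ (𝔪 : Ideal A.toSubring) [𝔪.IsMaximal],
        IsRegularLocalRing (Localization.AtPrime 𝔪) ∧ ringKrullDim (Localization.AtPrime 𝔪) = 3) →
      ∀ g₀ : K, (∀ c : K, c ^ p ≠ g₀) →
      ∃ T : Subalgebra k K, T.FG ∧ A ≤ T ∧ T.toSubring ≤ O.toSubring ∧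
        ∀ O' : ValuationSubring K, T.toSubring ≤ O'.toSubring →
          CleanRegAt p (locAtCentre T.toSubring O').subtype g₀ := by
  intro p hp k _ _ K _ _ O A hAO hAfg hfrac hdimA hmax g₀ hg₀
  classical
  haveI : Fact p.Prime := ⟨hp⟩
  haveI : CharP K p := charP_of_injective_algebraMap (algebraMap k K).injective p
  -- (1) a zero-dimensional refinement `A ⊆ O₀ ≤ O`
  obtain ⟨O₀, hO₀O, hAO₀, hzd⟩ := exists_zeroDim_refinement O A.toSubring hAO
  -- (2) its centre on `A` is maximal: `A_𝔭` regular of dimension `3`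
  haveI h𝔪 : (subringCentre A.toSubring O₀ hAO₀).IsMaximal := hzd A.toSubring hAO₀ le_rfl
  obtain ⟨hreg𝔪, hdim𝔪⟩ := hmax (subringCentre A.toSubring O₀ hAO₀)
  have hregO₀ : IsRegularLocalRing (locAtCentre A.toSubring O₀) :=
    (isRegularLocalRing_locAtCentre_iff hAO₀).mpr hreg𝔪
  have hdimO₀ : ringKrullDim (locAtCentre A.toSubring O₀) = 3 := by
    rw [← ringKrullDim_eq_of_ringEquiv (locAtCentreEquiv hAO₀).toRingEquiv]; exact hdim𝔪
  -- (3) clean local uniformization at `O₀`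
  obtain ⟨A', hA'O₀, hAA', hA'fg, hregR, c, hc, hloose⟩ :=
    hLU p hp k K O₀ A hAO₀ hAfg hfrac hdimA hregO₀ hdimO₀ g₀ hg₀
  have hAA's : A.toSubring ≤ A'.toSubring := fun x hx => hAA' hx
  have h𝔭' : (subringCentre A'.toSubring O₀ hA'O₀).IsMaximal := hzd A'.toSubring hA'O₀ hAA's
  have hX : LooseCleanForm p (locAtCentre A'.toSubring O₀).subtype (∑ j : Fin p, c j ^ p * g₀ ^ (j : ℕ)) :=
    looseCleanForm_of_forms hloose
  -- (4) spread from the closed centre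
  obtain ⟨h₂, c', hh₂, hc', H⟩ := exists_spread_of_looseCleanForm A' O₀ hA'O₀ hA'fg h𝔭' hregR g₀ c hc hX
  -- (5) the regular locus of `A'` is open: a basic open `D(h₁) ∋ 𝔭'` inside it
  letI : Algebra k A'.toSubring := inferInstanceAs (Algebra k A')
  haveI : Algebra.FiniteType k A'.toSubring := (A'.fg_iff_finiteType.mp hA'fg : Algebra.FiniteType k A')
  have hopen : IsOpen (regularLocus A'.toSubring) := (isJ2Ring_of_field k).2 A'.toSubring inferInstance
  have hmemReg : (⟨subringCentre A'.toSubring O₀ hA'O₀, inferInstance⟩ : PrimeSpectrum A'.toSubring) ∈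
      regularLocus A'.toSubring := (isRegularLocalRing_locAtCentre_iff hA'O₀).mp hregR
  obtain ⟨_, ⟨h₁, rfl⟩, h𝔭'h₁, hsub⟩ :=
    PrimeSpectrum.isTopologicalBasis_basic_opens.exists_subset_of_mem_open hmemReg hopen
  have hh₁ : h₁ ∉ subringCentre A'.toSubring O₀ hA'O₀ := (PrimeSpectrum.mem_basicOpen _ _).mp h𝔭'h₁
  -- (6) the element to invert
  have hhh : h₁ * h₂ ∉ subringCentre A'.toSubring O₀ hA'O₀ := fun hmem =>
    ((Ideal.IsPrime.mem_or_mem inferInstance hmem).elim hh₁ hh₂)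
  have hhh0 : ((h₁ * h₂ : A'.toSubring) : K) ≠ 0 := ne_zero_of_not_mem_subringCentre A' O₀ hA'O₀ hhh
  have hvhh : O₀.valuation ((h₁ * h₂ : A'.toSubring) : K) = 1 := valuation_eq_one_of_not_mem_subringCentre hA'O₀ hhh
  have hinvO₀ : ((h₁ * h₂ : A'.toSubring) : K)⁻¹ ∈ O₀ := by
    rw [← O₀.valuation_le_one_iff, map_inv₀, hvhh, inv_one]
  -- (7) the chart `T = A'[1/(h₁h₂)]`
  obtain ⟨s, hs⟩ := hA'fg
  let T : Subalgebra k K := Algebra.adjoin k (insert ((h₁ * h₂ : A'.toSubring) : K)⁻¹ (↑s : Set K))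
  have hA'T : A' ≤ T := by
    rw [← hs]; exact Algebra.adjoin_mono (Set.subset_insert _ _)
  have hTfg : T.FG := ⟨insert ((h₁ * h₂ : A'.toSubring) : K)⁻¹ s, by rw [Finset.coe_insert]⟩
  -- `T ⊆ O₀`
  let O₀alg : Subalgebra k K :=
    { O₀.toSubring.toSubsemiring with
      algebraMap_mem' := fun r => hA'O₀ (A'.algebraMap_mem r) }
  have hTO₀ : T.toSubring ≤ O₀.toSubring := by
    have hle : T ≤ O₀alg := by
      refine Algebra.adjoin_le (Set.insert_subset hinvO₀ fun x hx => ?_)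
      exact hA'O₀ (hs ▸ Algebra.subset_adjoin hx : x ∈ A')
    exact fun x hx => hle hx
  refine ⟨T, hTfg, hAA'.trans hA'T, fun x hx => hO₀O (hTO₀ hx), fun O' hTO' => ?_⟩
  -- (8) clean-regularity at the centre of an arbitrary `O' ⊇ T`
  have hA'O' : A'.toSubring ≤ O'.toSubring := fun x hx => hTO' (hA'T hx)
  have hinvO' : ((h₁ * h₂ : A'.toSubring) : K)⁻¹ ∈ O' := hTO' (Algebra.subset_adjoin (Set.mem_insert _ _))
  have hvhh' : O'.valuation ((h₁ * h₂ : A'.toSubring) : K) = 1 :=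
    valuation_eq_one_of_inv_mem hhh0 (hA'O' (h₁ * h₂).2) hinvO'
  have hhh𝔮 : h₁ * h₂ ∉ subringCentre A'.toSubring O' hA'O' := by
    rw [mem_subringCentre_iff, hvhh']; exact lt_irrefl 1
  have hh₁𝔮 : h₁ ∉ subringCentre A'.toSubring O' hA'O' := fun hmem => hhh𝔮 (Ideal.mul_mem_right _ _ hmem)
  have hh₂𝔮 : h₂ ∉ subringCentre A'.toSubring O' hA'O' := fun hmem => hhh𝔮 (Ideal.mul_mem_left _ _ hmem)
  -- `locAtCentre T O' = locAtCentre A' O'`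
  let Lalg : Subalgebra k K :=
    { (locAtCentre A'.toSubring O').toSubsemiring with
      algebraMap_mem' := fun r => le_locAtCentre A'.toSubring O' (A'.algebraMap_mem r) }
  have hTloc : T.toSubring ≤ locAtCentre A'.toSubring O' := by
    have hle : T ≤ Lalg := by
      refine Algebra.adjoin_le (Set.insert_subset ?_ fun x hx => ?_)
      · exact inv_mem_locAtCentre (le_locAtCentre A'.toSubring O' (h₁ * h₂).2) hvhh'
      · exact le_locAtCentre A'.toSubring O' (hs ▸ Algebra.subset_adjoin hx : x ∈ A')
    exact fun x hx => hle hx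
  rw [locAtCentre_eq_of_le_of_le (fun x hx => hA'T hx) hTloc]
  -- regularity at the centre `𝔮` of `O'` on `A'`
  have hreg𝔮 : IsRegularLocalRing (Localization.AtPrime (subringCentre A'.toSubring O' hA'O')) :=
    hsub ((PrimeSpectrum.mem_basicOpen _ ⟨subringCentre A'.toSubring O' hA'O', inferInstance⟩).mpr hh₁𝔮)
  haveI hregR' : IsRegularLocalRing (locAtCentre A'.toSubring O') :=
    (isRegularLocalRing_locAtCentre_iff hA'O').mpr hreg𝔮
  by_cases h𝔮 : subringCentre A'.toSubring O' hA'O' = subringCentre A'.toSubring O₀ hA'O₀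
  · -- same centre as `O₀`: same local ring, the original representative is clean there
    rw [locAtCentre_eq_of_subringCentre_eq hA'O' hA'O₀ h𝔮]
    exact ⟨hregR, c, hc, hX⟩
  · -- another centre off `h₁ h₂`: the spread
    haveI := isLocalization_locAtCentre hA'O'
    have H' := H (subringCentre A'.toSubring O' hA'O') hh₂𝔮 h𝔮 (locAtCentre A'.toSubring O')
    exact ⟨hregR', c', hc', H'⟩

end Summit.ResolutionOfSingularities.ResolutionOfSingularities.Theorems.RadicialJung.CleanModels

end
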